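import Literature.Barriers.FinalStateConjecture.ExtremalHorizonAxisymmetricDecayDecomposition
import Literature.Barriers.FinalStateConjecture.ExtremalHorizonTEnergy
import Literature.Barriers.FinalStateConjecture.ExtremalHorizonHardy
import Literature.Barriers.FinalStateConjecture.ExtremalHorizonFiniteSpeed
import HarnessLib

/-!
# Barrier catalogue `FinalStateConjecture`: uniform boundedness of the DEGENERATE shell energy
# of Aretakis's class outside the extremal Kerr horizon, and the reduction of
# `Aretakis2012_uniformBoundedness` to its near-horizon transversal term
# (`Literature/Barriers/FinalStateConjecture/`, D-0021, D-0014; family `gr`)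

Written from the proving seat of
`Literature.Barriers.FinalStateConjecture.Aretakis2012_uniformBoundedness`
(`ExtremalHorizonAxisymmetricDecayDecomposition.lean`; S. Aretakis, J. Funct. Anal. 263 (2012)
2770–2831, Thm. 2 with Thm. 4 in shell form: for the globally smooth, everywhere axisymmetric
members `Φ` of Aretakis's class and every `R₂ > M`,
`sup_{τ ≥ τ₀} ∫₀^{2π}∫₀^π∫_M^{R₂} sin θ (Φ² + (∂_ρΦ)²)(p(τ, r, θ, φ)) < ∞`).

In the source the bound has three constituents of very different depth:

* the zeroth-order term `Φ²` — the first Hardy inequality (§4.4, Prop. 4.4.1) and the conservation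
  of the degenerate `T`-energy (§5.1, Prop. 5.1.2: "boundedness of `T`-flux through `Σ_τ`");
* the transversal term `(∂_ρΦ)²` on `{r ≥ M + δ}` — again Prop. 5.1.2, the degenerate weight
  `(1 − M/r)²` of `J^T_μ n^μ ∼ (Tψ)² + (1 − M/r)²(Yψ)² + |∇̸ψ|²` being harmless away from `𝓗⁺`;
* the transversal term on the layer `{M ≤ r ≤ M + δ}` — Thm. 2 proper (§13.1: the current
  `J^{N,δ,−1/2}`, the Hardy inequalities, AND the integrated local energy decay Prop. 12.5.1 of
  §§9–12 in the transition region of the cut-off; §1.2.2: "in the extreme case the degeneracy of the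
  redshift makes understanding of dispersion of `ψ` essential even for the problem of boundedness").

**This file proves the first two for the class and reduces the named fact to the third**, in the
catalogue's vocabulary (`Kerr.shellIntegral`, `Kerr.shellPoint`, `Kerr.degTEnergyDensity`):

* `Kerr.degTEnergyBox_le_initial` — **Prop. 5.1.2 + finite speed of propagation**: for `τ ≥ 0`,
  `R ≥ M` and every `φ₀`,
  `∫₀^π∫_M^R e_T(τ) dr dθ ≤ ∫₀^π∫_M^{R₀} e_T(0) dr dθ`, `R₀ = max(ρ, 2M) + 2`,
  `e_T = Kerr.degTEnergyDensity M Φ` (`Kerr.degTEnergy_antitone_and_horizonFlux_le` on `[M, r₂]`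
  with `r₂` beyond the support of the wave at all times `≤ τ`, `Kerr.fderiv_shellPoint_eq_zero_of_far`);
  `Kerr.degTEnergyShell_le_initial` — the same integrated over `φ₀ ∈ [0, 2π]`;
* `Kerr.shellIntegral_sq_le_initialEnergy` — **the `Φ²` bound**:
  `∫₀^{2π}∫₀^π∫_M^R sin θ Φ² ≤ 8 E₀` for `τ ≥ 0` (`Kerr.shellIntegral_sq_le_four_mul_degenerate`
  on `[M, r₂]`, `Φ = 0` on the far sphere, and `sin θ (r − M)²(∂_ρΦ)² ≤ 2 e_T`);
* `Kerr.shellIntegral_rhoDeriv_sq_far_le` — **the transversal term away from `𝓗⁺`**: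
  `∫₀^{2π}∫₀^π∫_{M+δ}^R sin θ (∂_ρΦ)² ≤ (2/δ²) E₀` for `τ ≥ 0`, `δ > 0`;
* `Aretakis2012_uniformBoundedness_of_nearHorizonBound` — **the reduction**: the named fact follows
  from the near-horizon statement "for every member of the class there are `δ > 0`, `τ₀`, `C` with
  `∫₀^{2π}∫₀^π∫_M^{M+δ} sin θ (∂_ρΦ)²(p(τ, r, θ, φ)) ≤ C` for `τ ≥ τ₀`" — the uniform boundedness of
  the non-degenerate energy on a collar of `𝓗⁺`, i.e. Thm. 2 of the source (§13.1).

Here `E₀ = ∫₀^{2π}∫₀^π∫_M^{R₀} e_T(0)` is the initial degenerate energy of the data (the density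
vanishes beyond `R₀` on the initial leaf). Everything is proved; no named facts (D-0026).

## References

* S. Aretakis, *Decay of axisymmetric solutions of the wave equation on extreme Kerr
  backgrounds*, J. Funct. Anal. 263 (2012) 2770–2831 (arXiv:1110.2006): §3 Thm. 2; §4.4
  Prop. 4.4.1; §5.1 Prop. 5.1.2; §13.1 (proof of Thm. 2). [Aretakis2012]
-/

noncomputable section

open Set Filter MeasureTheory intervalIntegral
open scoped Topology ContDiff Manifold

namespace Literature.Barriers.FinalStateConjecture.Kerr

open Literature.Geometry.Lorentzian

/-! ### Continuity and sign of the degenerate `T`-energy density -/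

/-- Joint continuity of the `∂_θ`-frame `(r, θ, φ) ↦ (0, r θ̂ + M cos θ φ̂)` of the ingoing
spheroidal coordinates. [folklore] -/
theorem continuous_spaceEmbed_thetaFrame (M : ℝ) :
    Continuous fun q : ℝ × ℝ × ℝ ↦
      E4.spaceEmbed (q.1 • sphPolar q.2.1 q.2.2 + (M * Real.cos q.2.1) • sphAzimuth q.2.2) := by
  refine E4.spaceEmbed.continuous.comp ?_
  simp only [sphPolar_eq, sphAzimuth_eq]
  fun_prop

/-- Joint continuity of `(τ, r, θ, φ₀) ↦ e_T(τ, r, θ, φ₀)` for `Φ ∈ C¹(E4)`. [folklore] -/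
theorem continuous_degTEnergyDensity₄ {Φ : E4 → ℝ} (hΦ : ContDiff ℝ 1 Φ) (M : ℝ) :
    Continuous fun q : ℝ × ℝ × ℝ × ℝ ↦ degTEnergyDensity M Φ q.1 q.2.1 q.2.2.1 q.2.2.2 := by
  have hD : Continuous fun q : ℝ × ℝ × ℝ × ℝ ↦ fderiv ℝ Φ (shellPoint M q.1 q.2.1 q.2.2.1 q.2.2.2) :=
    (hΦ.continuous_fderiv one_ne_zero).comp (continuous_shellPoint₄ M)
  have h1 := continuous_rhoDeriv_shellPoint₄ hΦ M
  have h0 : Continuous fun q : ℝ × ℝ × ℝ × ℝ ↦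
      fderiv ℝ Φ (shellPoint M q.1 q.2.1 q.2.2.1 q.2.2.2) (E4.basisVector 0) :=
    hD.clm_apply continuous_const
  have h2 : Continuous fun q : ℝ × ℝ × ℝ × ℝ ↦
      fderiv ℝ Φ (shellPoint M q.1 q.2.1 q.2.2.1 q.2.2.2)
        (E4.spaceEmbed (q.2.1 • sphPolar q.2.2.1 q.2.2.2 +
          (M * Real.cos q.2.2.1) • sphAzimuth q.2.2.2)) :=
    hD.clm_apply ((continuous_spaceEmbed_thetaFrame M).comp continuous_snd)
  have hθ : Continuous fun q : ℝ × ℝ × ℝ × ℝ ↦ q.2.2.1 :=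
    continuous_fst.comp (continuous_snd.comp continuous_snd)
  have hr : Continuous fun q : ℝ × ℝ × ℝ × ℝ ↦ q.2.1 := continuous_fst.comp continuous_snd
  unfold degTEnergyDensity
  exact (continuous_const.mul (Real.continuous_sin.comp hθ)).mul
    (((((hr.sub continuous_const).pow 2).mul (h1.pow 2)).add
      ((((hr.pow 2).add (continuous_const.mul ((Real.continuous_cos.comp hθ).pow 2))).add
        (continuous_const.mul hr)).mul (h0.pow 2))).add (h2.pow 2))

/-- Joint continuity of `(r, θ) ↦ e_T(t, r, θ, φ₀)` for `Φ ∈ C¹(E4)`. [folklore] -/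
theorem continuous_degTEnergyDensity_rθ {Φ : E4 → ℝ} (hΦ : ContDiff ℝ 1 Φ) (M t φ₀ : ℝ) :
    Continuous (Function.uncurry fun r θ ↦ degTEnergyDensity M Φ t r θ φ₀) := by
  have hg : Continuous fun p : ℝ × ℝ ↦ ((t, p.1, p.2, φ₀) : ℝ × ℝ × ℝ × ℝ) := by fun_prop
  have h := (continuous_degTEnergyDensity₄ hΦ M).comp hg
  rw [Function.comp_def] at h
  exact h

/-- Joint continuity of `(r, θ, φ₀) ↦ e_T(t, r, θ, φ₀)` for `Φ ∈ C¹(E4)`. [folklore] -/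
theorem continuous_degTEnergyDensity₃ {Φ : E4 → ℝ} (hΦ : ContDiff ℝ 1 Φ) (M t : ℝ) :
    Continuous fun q : ℝ × ℝ × ℝ ↦ degTEnergyDensity M Φ t q.1 q.2.1 q.2.2 := by
  have hg : Continuous fun p : ℝ × ℝ × ℝ ↦ ((t, p.1, p.2.1, p.2.2) : ℝ × ℝ × ℝ × ℝ) := by fun_prop
  have h := (continuous_degTEnergyDensity₄ hΦ M).comp hg
  rw [Function.comp_def] at h
  exact h

/-- The degenerate `T`-energy density is non-negative for `M ≥ 0`, `r ≥ 0`, `θ ∈ [0, π]`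
(Prop. 5.1.1 of the source in coordinates: a sum of squares times `sin θ ≥ 0`).
[cite: Aretakis2012, §5.1 (Prop. 5.1.1)] -/
theorem degTEnergyDensity_nonneg {M : ℝ} (hM : 0 ≤ M) (Φ : E4 → ℝ) (t : ℝ) {r θ : ℝ} (hr : 0 ≤ r)
    (hθ : θ ∈ Icc (0 : ℝ) Real.pi) (φ₀ : ℝ) : 0 ≤ degTEnergyDensity M Φ t r θ φ₀ := by
  have hs : 0 ≤ Real.sin θ := Real.sin_nonneg_of_nonneg_of_le_pi hθ.1 hθ.2
  have hc : 0 ≤ r ^ 2 + M ^ 2 * Real.cos θ ^ 2 + 2 * M * r := by positivity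
  unfold degTEnergyDensity
  refine mul_nonneg (mul_nonneg (by norm_num) hs) ?_
  exact add_nonneg (add_nonneg (mul_nonneg (sq_nonneg _) (sq_nonneg _))
    (mul_nonneg hc (sq_nonneg _))) (sq_nonneg _)

/-- The degenerate transversal term is dominated by twice the density:
`sin θ (r − M)²(∂_ρΦ)² ≤ 2 e_T` (`M ≥ 0`, `r ≥ 0`, `θ ∈ [0, π]`). [cite: Aretakis2012, §5.1] -/
theorem sin_mul_degenerate_le_two_mul_degTEnergyDensity {M : ℝ} (hM : 0 ≤ M) (Φ : E4 → ℝ)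
    (t : ℝ) {r θ : ℝ} (hr : 0 ≤ r) (hθ : θ ∈ Icc (0 : ℝ) Real.pi) (φ₀ : ℝ) :
    Real.sin θ * ((r - M) ^ 2 *
        (fderiv ℝ Φ (shellPoint M t r θ φ₀) (E4.spaceEmbed (sphRadial θ φ₀))) ^ 2) ≤
      2 * degTEnergyDensity M Φ t r θ φ₀ := by
  have hs : 0 ≤ Real.sin θ := Real.sin_nonneg_of_nonneg_of_le_pi hθ.1 hθ.2
  have hc : 0 ≤ r ^ 2 + M ^ 2 * Real.cos θ ^ 2 + 2 * M * r := by positivity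
  unfold degTEnergyDensity
  set D0 := fderiv ℝ Φ (shellPoint M t r θ φ₀) (E4.basisVector 0)
  set D2 := fderiv ℝ Φ (shellPoint M t r θ φ₀)
    (E4.spaceEmbed (r • sphPolar θ φ₀ + (M * Real.cos θ) • sphAzimuth φ₀))
  nlinarith [mul_nonneg hs (mul_nonneg hc (sq_nonneg D0)), mul_nonneg hs (sq_nonneg D2)]

/-! ### Calculus of the box integrals `∫₀^π∫_a^b g(r, θ) dr dθ` -/

/-- Continuity in `θ` of the inner `r`-integral of a jointly continuous integrand. [folklore] -/
theorem continuous_rIntegral {a b : ℝ} {g : ℝ → ℝ → ℝ} (hg : Continuous (Function.uncurry g)) :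
    Continuous fun θ ↦ ∫ r in a..b, g r θ := by
  have h : Continuous (Function.uncurry fun θ r ↦ g r θ) := hg.comp continuous_swap
  exact intervalIntegral.continuous_parametric_intervalIntegral_of_continuous' h a b

/-- **Monotonicity of the box integral in the `r`-interval** for a nonnegative jointly continuous
integrand: `[a, b] ⊆ [a, d]`. [folklore] -/
theorem boxIntegral_mono_interval {a b d : ℝ} (hab : a ≤ b) (hbd : b ≤ d) {g : ℝ → ℝ → ℝ}
    (hg : Continuous (Function.uncurry g))
    (h0 : ∀ r ∈ Icc a d, ∀ θ ∈ Icc (0 : ℝ) Real.pi, 0 ≤ g r θ) :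
    (∫ θ in (0 : ℝ)..Real.pi, ∫ r in a..b, g r θ) ≤ ∫ θ in (0 : ℝ)..Real.pi, ∫ r in a..d, g r θ := by
  refine intervalIntegral.integral_mono_on Real.pi_pos.le
    ((continuous_rIntegral hg).intervalIntegrable _ _)
    ((continuous_rIntegral hg).intervalIntegrable _ _) fun θ hθ ↦ ?_
  have hgr : Continuous fun r ↦ g r θ := hg.comp (Continuous.prodMk continuous_id continuous_const)
  refine intervalIntegral.integral_mono_interval le_rfl hab hbd ?_ (hgr.intervalIntegrable _ _)
  filter_upwards [ae_restrict_mem measurableSet_Ioc] with r hr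
  exact h0 r ⟨hr.1.le, hr.2⟩ θ hθ

/-- **Pointwise comparison of box integrals** (`a ≤ b`). [folklore] -/
theorem boxIntegral_mono_on {a b : ℝ} (hab : a ≤ b) {f g : ℝ → ℝ → ℝ}
    (hf : Continuous (Function.uncurry f)) (hg : Continuous (Function.uncurry g))
    (h : ∀ r ∈ Icc a b, ∀ θ ∈ Icc (0 : ℝ) Real.pi, f r θ ≤ g r θ) :
    (∫ θ in (0 : ℝ)..Real.pi, ∫ r in a..b, f r θ) ≤ ∫ θ in (0 : ℝ)..Real.pi, ∫ r in a..b, g r θ := by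
  refine intervalIntegral.integral_mono_on Real.pi_pos.le
    ((continuous_rIntegral hf).intervalIntegrable _ _)
    ((continuous_rIntegral hg).intervalIntegrable _ _) fun θ hθ ↦ ?_
  have hfr : Continuous fun r ↦ f r θ := hf.comp (Continuous.prodMk continuous_id continuous_const)
  have hgr : Continuous fun r ↦ g r θ := hg.comp (Continuous.prodMk continuous_id continuous_const)
  exact intervalIntegral.integral_mono_on hab (hfr.intervalIntegrable _ _) (hgr.intervalIntegrable _ _)
    fun r hr ↦ h r hr θ hθ

/-- **Splitting the box integral at an intermediate radius.** [folklore] -/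
theorem boxIntegral_split {a b c : ℝ} {g : ℝ → ℝ → ℝ} (hg : Continuous (Function.uncurry g)) :
    (∫ θ in (0 : ℝ)..Real.pi, ∫ r in a..c, g r θ) =
      (∫ θ in (0 : ℝ)..Real.pi, ∫ r in a..b, g r θ) + ∫ θ in (0 : ℝ)..Real.pi, ∫ r in b..c, g r θ := by
  rw [← intervalIntegral.integral_add ((continuous_rIntegral hg).intervalIntegrable _ _)
    ((continuous_rIntegral hg).intervalIntegrable _ _)]
  refine intervalIntegral.integral_congr fun θ _ ↦ ?_
  have hgr : Continuous fun r ↦ g r θ := hg.comp (Continuous.prodMk continuous_id continuous_const)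
  exact (intervalIntegral.integral_add_adjacent_intervals (hgr.intervalIntegrable _ _)
    (hgr.intervalIntegrable _ _)).symm

/-- A box integral over an `r`-range on which the integrand vanishes is zero. [folklore] -/
theorem boxIntegral_eq_zero_of {a b : ℝ} {g : ℝ → ℝ → ℝ}
    (h : ∀ r ∈ uIcc a b, ∀ θ ∈ Icc (0 : ℝ) Real.pi, g r θ = 0) :
    (∫ θ in (0 : ℝ)..Real.pi, ∫ r in a..b, g r θ) = 0 := by
  have h' : ∀ θ ∈ uIcc (0 : ℝ) Real.pi, (∫ r in a..b, g r θ) = (fun _ ↦ (0 : ℝ)) θ := by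
    intro θ hθ
    rw [uIcc_of_le Real.pi_pos.le] at hθ
    rw [intervalIntegral.integral_congr (g := fun _ ↦ (0 : ℝ)) (fun r hr ↦ h r hr θ hθ)]
    simp
  rw [intervalIntegral.integral_congr (g := fun _ ↦ (0 : ℝ)) h']
  simp

/-- The constant `c` comes out of a box integral. [folklore] -/
theorem boxIntegral_const_mul (c : ℝ) {a b : ℝ} (g : ℝ → ℝ → ℝ) :
    (∫ θ in (0 : ℝ)..Real.pi, ∫ r in a..b, c * g r θ) = c * ∫ θ in (0 : ℝ)..Real.pi, ∫ r in a..b, g r θ := by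
  simp only [intervalIntegral.integral_const_mul]

/-- Continuity in `φ` of the box integral `∫₀^π∫_{R₁}^{R₂} g(r, θ, φ) dr dθ` for a jointly
continuous `g`. [folklore] -/
theorem continuous_boxIntegral_phi {R₁ R₂ : ℝ} {g : ℝ → ℝ → ℝ → ℝ}
    (hg : Continuous fun q : ℝ × ℝ × ℝ ↦ g q.1 q.2.1 q.2.2) :
    Continuous fun φ ↦ ∫ θ in (0 : ℝ)..Real.pi, ∫ r in R₁..R₂, g r θ φ :=
  continuous_rIntegral (continuous_inner_of_continuous hg)

/-- **Splitting a shell integral at an intermediate radius** (jointly continuous integrand).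
[folklore] -/
theorem shellIntegral_split {a b c : ℝ} {g : ℝ → ℝ → ℝ → ℝ}
    (hg : Continuous fun q : ℝ × ℝ × ℝ ↦ g q.1 q.2.1 q.2.2) :
    shellIntegral a c g = shellIntegral a b g + shellIntegral b c g := by
  unfold shellIntegral
  rw [← intervalIntegral.integral_add ((continuous_boxIntegral_phi hg).intervalIntegrable _ _)
    ((continuous_boxIntegral_phi hg).intervalIntegrable _ _)]
  refine intervalIntegral.integral_congr fun φ _ ↦ ?_
  have hgφ : Continuous (Function.uncurry fun r θ ↦ g r θ φ) :=
    hg.comp (Continuous.prodMk continuous_fst (Continuous.prodMk continuous_snd continuous_const))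
  exact boxIntegral_split hgφ

/-! ### The degenerate `T`-energy of the shells is bounded by the initial energy -/

section DegenerateEnergy

variable [Kerr.Facts] [Kerr.SliceFacts] {M r₀ : ℝ} {U₀ : Set (Kerr.region M r₀)} {Φ : E4 → ℝ}

/-- **Uniform boundedness of the degenerate `T`-energy of the shells (Aretakis 2012, Prop. 5.1.2
with finite speed of propagation), box form.** For a globally smooth, everywhere axisymmetric member
`Φ` of Aretakis's class with data supported in `{‖x⃗‖ ≤ ρ}` on the initial leaf, every `τ ≥ 0`,
`R ≥ M` and `φ₀`:
`∫₀^π∫_M^R e_T(τ, r, θ, φ₀) dr dθ ≤ ∫₀^π∫_M^{R₀} e_T(0, r, θ, φ₀) dr dθ`, `R₀ = max(ρ, 2M) + 2`.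
Proof: enlarge `[M, R]` to `[M, r₂]` with `r₂ > max(ρ, 2M) + 1 + τ` (nonnegative density), apply the
conservation law on `[M, r₂] × [0, τ]` (no flux through `{r = r₂}` by
`Kerr.fderiv_shellPoint_eq_zero_of_far`), and drop `[R₀, r₂]` at `t* = 0`, where the density
vanishes. [cite: Aretakis2012, §5.1 (Prop. 5.1.2)] -/
theorem degTEnergyBox_le_initial (hM : 0 < M) (hr₀ : r₀ ∈ Set.Ioo 0 M) (hU₀ : IsOpen U₀)
    (hKU : {x : Kerr.region M r₀ | Kerr.rPlus M M ≤ Kerr.radius M (x : E4) ∧ 0 ≤ (x : E4) 0} ⊆ U₀)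
    (hΦ : ContDiff ℝ ∞ Φ)
    (haxi : ∀ (β : ℝ) (z : E4), Φ (E4.axialRotation β z) = Φ z)
    (hsol : ∀ x ∈ U₀, (Kerr.smoothMetric M M r₀).toPseudoRiemannianMetric.dalembertian
      (fun y : Kerr.region M r₀ ↦ Φ y) x = 0)
    {ρ : ℝ} (hloc : ∀ x ∈ U₀, (x : E4) 0 = 0 → ρ < E4.spatialNorm (x : E4) →
      Φ x = 0 ∧ fderiv ℝ Φ x = 0)
    {τ R : ℝ} (hτ : 0 ≤ τ) (hR : M ≤ R) (φ₀ : ℝ) :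
    (∫ θ in (0 : ℝ)..Real.pi, ∫ r in M..R, degTEnergyDensity M Φ τ r θ φ₀) ≤
      ∫ θ in (0 : ℝ)..Real.pi, ∫ r in M..(max ρ (2 * M) + 2), degTEnergyDensity M Φ 0 r θ φ₀ := by
  have hΦ' : ∀ x ∈ U₀, ContDiffAt ℝ ∞ Φ x := fun x _ ↦ hΦ.contDiffAt
  have haxi' : ∀ (β : ℝ) (z : E4), 0 < Kerr.radius M z → Φ (E4.axialRotation β z) = Φ z :=
    fun β z _ ↦ haxi β z
  have hΦ1 : ContDiff ℝ 1 Φ := hΦ.of_le (by exact_mod_cast le_top)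
  obtain ⟨r₂, hr₂⟩ : ∃ r₂ : ℝ, r₂ = max R (max ρ (2 * M) + τ + 2) := ⟨_, rfl⟩
  have hRr₂ : R ≤ r₂ := hr₂ ▸ le_max_left _ _
  have hMr₂ : M ≤ r₂ := hR.trans hRr₂
  have hr₂' : max ρ (2 * M) + τ + 2 ≤ r₂ := hr₂ ▸ le_max_right _ _
  have hR₀r₂ : max ρ (2 * M) + 2 ≤ r₂ := by linarith
  have hfar₂ : max ρ (2 * M) + 1 + τ < r₂ := by linarith
  -- continuity and sign of the densities in `(r, θ)`
  have hc : ∀ t : ℝ, Continuous (Function.uncurry fun r θ ↦ degTEnergyDensity M Φ t r θ φ₀) :=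
    fun t ↦ continuous_degTEnergyDensity_rθ hΦ1 M t φ₀
  have h0 : ∀ t : ℝ, ∀ r ∈ Icc M r₂, ∀ θ ∈ Icc (0 : ℝ) Real.pi,
      0 ≤ degTEnergyDensity M Φ t r θ φ₀ :=
    fun t r hr θ hθ ↦ degTEnergyDensity_nonneg hM.le Φ t (hM.le.trans hr.1) hθ φ₀
  -- (1) enlarge the shell
  have h1 : (∫ θ in (0 : ℝ)..Real.pi, ∫ r in M..R, degTEnergyDensity M Φ τ r θ φ₀) ≤
      ∫ θ in (0 : ℝ)..Real.pi, ∫ r in M..r₂, degTEnergyDensity M Φ τ r θ φ₀ :=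
    boxIntegral_mono_interval hR hRr₂ (hc τ) (h0 τ)
  -- (2) conservation on `[M, r₂]` between `0` and `τ`
  have hfar : ∀ t ∈ Icc 0 τ, ∀ θ ∈ Icc (0 : ℝ) Real.pi,
      fderiv ℝ Φ (shellPoint M t r₂ θ φ₀) = 0 :=
    fun t ht θ _ ↦ (fderiv_shellPoint_eq_zero_of_far hM hr₀ hU₀ hKU hΦ' hsol hloc hfar₂ ht.1
      ht.2 θ φ₀).2
  have h2 : (∫ θ in (0 : ℝ)..Real.pi, ∫ r in M..r₂, degTEnergyDensity M Φ τ r θ φ₀) ≤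
      ∫ θ in (0 : ℝ)..Real.pi, ∫ r in M..r₂, degTEnergyDensity M Φ 0 r θ φ₀ :=
    (degTEnergy_antitone_and_horizonFlux_le hM hr₀ hU₀ hKU hΦ' haxi' hsol (t₁ := 0) (t₂ := τ)
      le_rfl hτ hMr₂ hfar).1
  -- (3) at `t* = 0` the density vanishes beyond `R₀ = max ρ (2M) + 2`
  have h3 : (∫ θ in (0 : ℝ)..Real.pi, ∫ r in M..r₂, degTEnergyDensity M Φ 0 r θ φ₀) =
      ∫ θ in (0 : ℝ)..Real.pi, ∫ r in M..(max ρ (2 * M) + 2), degTEnergyDensity M Φ 0 r θ φ₀ := by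
    rw [boxIntegral_split (b := max ρ (2 * M) + 2) (hc 0),
      boxIntegral_eq_zero_of (a := max ρ (2 * M) + 2) (b := r₂), add_zero]
    intro r hr θ _
    rw [uIcc_of_le hR₀r₂] at hr
    have hfar₀ : max ρ (2 * M) + 1 + 0 < r := by linarith [hr.1]
    obtain ⟨-, hd⟩ := fderiv_shellPoint_eq_zero_of_far hM hr₀ hU₀ hKU hΦ' hsol hloc hfar₀
      le_rfl le_rfl θ φ₀
    simp [degTEnergyDensity, hd]
  exact (h1.trans h2).trans_eq h3

/-- **Uniform boundedness of the degenerate `T`-energy of the shells, shell form**: for `τ ≥ 0`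
and `R ≥ M`, `∫₀^{2π}∫₀^π∫_M^R e_T(τ) ≤ E₀ := ∫₀^{2π}∫₀^π∫_M^{R₀} e_T(0)`, `R₀ = max(ρ, 2M) + 2`
("boundedness of `T`-flux through `Σ_τ`", the Proposition used at the end of §13.1).
[cite: Aretakis2012, §5.1 (Prop. 5.1.2)] -/
theorem degTEnergyShell_le_initial (hM : 0 < M) (hr₀ : r₀ ∈ Set.Ioo 0 M) (hU₀ : IsOpen U₀)
    (hKU : {x : Kerr.region M r₀ | Kerr.rPlus M M ≤ Kerr.radius M (x : E4) ∧ 0 ≤ (x : E4) 0} ⊆ U₀)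
    (hΦ : ContDiff ℝ ∞ Φ)
    (haxi : ∀ (β : ℝ) (z : E4), Φ (E4.axialRotation β z) = Φ z)
    (hsol : ∀ x ∈ U₀, (Kerr.smoothMetric M M r₀).toPseudoRiemannianMetric.dalembertian
      (fun y : Kerr.region M r₀ ↦ Φ y) x = 0)
    {ρ : ℝ} (hloc : ∀ x ∈ U₀, (x : E4) 0 = 0 → ρ < E4.spatialNorm (x : E4) →
      Φ x = 0 ∧ fderiv ℝ Φ x = 0)
    {τ R : ℝ} (hτ : 0 ≤ τ) (hR : M ≤ R) :
    shellIntegral M R (fun r θ φ ↦ degTEnergyDensity M Φ τ r θ φ) ≤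
      shellIntegral M (max ρ (2 * M) + 2) (fun r θ φ ↦ degTEnergyDensity M Φ 0 r θ φ) := by
  have hΦ1 : ContDiff ℝ 1 Φ := hΦ.of_le (by exact_mod_cast le_top)
  unfold shellIntegral
  refine intervalIntegral.integral_mono_on (by positivity)
    ((continuous_boxIntegral_phi (continuous_degTEnergyDensity₃ hΦ1 M τ)).intervalIntegrable _ _)
    ((continuous_boxIntegral_phi (continuous_degTEnergyDensity₃ hΦ1 M 0)).intervalIntegrable _ _)
    fun φ₀ _ ↦ ?_
  exact degTEnergyBox_le_initial hM hr₀ hU₀ hKU hΦ haxi hsol hloc hτ hR φ₀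

omit [Kerr.Facts] [Kerr.SliceFacts] in
/-- The initial degenerate energy `E₀` is non-negative. [cite: Aretakis2012, §5.1 (Prop. 5.1.1)] -/
theorem initialDegTEnergyShell_nonneg (hM : 0 < M) (hΦ : ContDiff ℝ ∞ Φ) (ρ : ℝ) :
    0 ≤ shellIntegral M (max ρ (2 * M) + 2) (fun r θ φ ↦ degTEnergyDensity M Φ 0 r θ φ) := by
  have hΦ1 : ContDiff ℝ 1 Φ := hΦ.of_le (by exact_mod_cast le_top)
  have hMR : M ≤ max ρ (2 * M) + 2 := by
    have := le_max_right ρ (2 * M); linarith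
  exact shellIntegral_nonneg hMR (continuous_degTEnergyDensity₃ hΦ1 M 0)
    fun r hr θ hθ φ _ ↦ degTEnergyDensity_nonneg hM.le Φ 0 (hM.le.trans hr.1) hθ φ

/-- **The zeroth-order term: `∫₀^{2π}∫₀^π∫_M^R sin θ Φ² ≤ 8 E₀` for `τ ≥ 0`, `R ≥ M`** (first Hardy
inequality on `[M, r₂]` with `r₂` beyond the support of the wave on the leaf `{t* = τ}`, then
`sin θ (r − M)²(∂_ρΦ)² ≤ 2 e_T` and the boundedness of the degenerate energy).
[cite: Aretakis2012, §4.4 (Prop. 4.4.1) and §13.1] -/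
theorem shellIntegral_sq_le_initialEnergy (hM : 0 < M) (hr₀ : r₀ ∈ Set.Ioo 0 M) (hU₀ : IsOpen U₀)
    (hKU : {x : Kerr.region M r₀ | Kerr.rPlus M M ≤ Kerr.radius M (x : E4) ∧ 0 ≤ (x : E4) 0} ⊆ U₀)
    (hΦ : ContDiff ℝ ∞ Φ)
    (haxi : ∀ (β : ℝ) (z : E4), Φ (E4.axialRotation β z) = Φ z)
    (hsol : ∀ x ∈ U₀, (Kerr.smoothMetric M M r₀).toPseudoRiemannianMetric.dalembertian
      (fun y : Kerr.region M r₀ ↦ Φ y) x = 0)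
    {ρ : ℝ} (hloc : ∀ x ∈ U₀, (x : E4) 0 = 0 → ρ < E4.spatialNorm (x : E4) →
      Φ x = 0 ∧ fderiv ℝ Φ x = 0)
    {τ R : ℝ} (hτ : 0 ≤ τ) (hR : M ≤ R) :
    shellIntegral M R (fun r θ φ ↦ Real.sin θ * Φ (shellPoint M τ r θ φ) ^ 2) ≤
      8 * shellIntegral M (max ρ (2 * M) + 2) (fun r θ φ ↦ degTEnergyDensity M Φ 0 r θ φ) := by
  have hΦ' : ∀ x ∈ U₀, ContDiffAt ℝ ∞ Φ x := fun x _ ↦ hΦ.contDiffAt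
  have hΦ1 : ContDiff ℝ 1 Φ := hΦ.of_le (by exact_mod_cast le_top)
  obtain ⟨r₂, hr₂⟩ : ∃ r₂ : ℝ, r₂ = max R (max ρ (2 * M) + τ + 2) := ⟨_, rfl⟩
  have hRr₂ : R ≤ r₂ := hr₂ ▸ le_max_left _ _
  have hMr₂ : M ≤ r₂ := hR.trans hRr₂
  have hr₂' : max ρ (2 * M) + τ + 2 ≤ r₂ := hr₂ ▸ le_max_right _ _
  have hfar₂ : max ρ (2 * M) + 1 + τ < r₂ := by linarith
  -- `Φ` vanishes on the far sphere `{r = r₂}` of the leaf `{t* = τ}`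
  have hzero : ∀ θ φ : ℝ, Φ (shellPoint M τ r₂ θ φ) = 0 := fun θ φ ↦
    (fderiv_shellPoint_eq_zero_of_far hM hr₀ hU₀ hKU hΦ' hsol hloc hfar₂ hτ le_rfl θ φ).1
  -- continuity of the integrands
  have hsin : Continuous fun q : ℝ × ℝ × ℝ ↦ Real.sin q.2.1 :=
    Real.continuous_sin.comp (continuous_fst.comp continuous_snd)
  have hsq : Continuous fun q : ℝ × ℝ × ℝ ↦ Real.sin q.2.1 * Φ (shellPoint M τ q.1 q.2.1 q.2.2) ^ 2 :=
    hsin.mul ((hΦ.continuous.comp (continuous_shellPoint M τ)).pow 2)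
  have hDc : Continuous fun q : ℝ × ℝ × ℝ ↦
      fderiv ℝ Φ (shellPoint M τ q.1 q.2.1 q.2.2) (E4.spaceEmbed (sphRadial q.2.1 q.2.2)) :=
    ((hΦ1.continuous_fderiv one_ne_zero).comp (continuous_shellPoint M τ)).clm_apply
      (continuous_spaceEmbed_sphRadial.comp continuous_snd)
  have hdeg : Continuous fun q : ℝ × ℝ × ℝ ↦ Real.sin q.2.1 * ((q.1 - M) ^ 2 *
      (fderiv ℝ Φ (shellPoint M τ q.1 q.2.1 q.2.2) (E4.spaceEmbed (sphRadial q.2.1 q.2.2))) ^ 2) :=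
    hsin.mul (((continuous_fst.sub continuous_const).pow 2).mul (hDc.pow 2))
  have h2e : Continuous fun q : ℝ × ℝ × ℝ ↦ 2 * degTEnergyDensity M Φ τ q.1 q.2.1 q.2.2 :=
    continuous_const.mul (continuous_degTEnergyDensity₃ hΦ1 M τ)
  -- (1) enlarge the shell
  have h1 : shellIntegral M R (fun r θ φ ↦ Real.sin θ * Φ (shellPoint M τ r θ φ) ^ 2) ≤
      shellIntegral M r₂ (fun r θ φ ↦ Real.sin θ * Φ (shellPoint M τ r θ φ) ^ 2) :=
    shellIntegral_mono_interval le_rfl hR hRr₂ hsq fun r _ θ hθ φ _ ↦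
      mul_nonneg (Real.sin_nonneg_of_nonneg_of_le_pi hθ.1 hθ.2) (sq_nonneg _)
  -- (2) the Hardy inequality on `[M, r₂]`
  have h2 := shellIntegral_sq_le_four_mul_degenerate hMr₂ hΦ1 hzero
  -- (3) the degenerate transversal term is dominated by the `T`-energy density
  have h3 : shellIntegral M r₂ (fun r θ φ ↦ Real.sin θ * ((r - M) ^ 2 *
      (fderiv ℝ Φ (shellPoint M τ r θ φ) (E4.spaceEmbed (sphRadial θ φ))) ^ 2)) ≤
      2 * shellIntegral M r₂ (fun r θ φ ↦ degTEnergyDensity M Φ τ r θ φ) := by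
    rw [← shellIntegral_const_mul]
    exact shellIntegral_mono_on hMr₂ hdeg h2e fun r hr θ hθ φ _ ↦
      sin_mul_degenerate_le_two_mul_degTEnergyDensity hM.le Φ τ (hM.le.trans hr.1) hθ φ
  -- (4) the degenerate energy is bounded by the initial one
  have h4 := degTEnergyShell_le_initial hM hr₀ hU₀ hKU hΦ haxi hsol hloc hτ hMr₂
  linarith

/-- **The transversal term away from the horizon: `∫₀^{2π}∫₀^π∫_{M+δ}^R sin θ (∂_ρΦ)² ≤ (2/δ²) E₀`
for `τ ≥ 0`, `δ > 0`, `R ≥ M + δ`** (the degenerate weight `(r − M)² ≥ δ²` of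
`J^T_μ n^μ ∼ (Tψ)² + (1 − M/r)²(Yψ)² + |∇̸ψ|²` is harmless away from `𝓗⁺`).
[cite: Aretakis2012, §5.1 (Prop. 5.1.2) and §3 (the remark on `J^T_μ n^μ`)] -/
theorem shellIntegral_rhoDeriv_sq_far_le (hM : 0 < M) (hr₀ : r₀ ∈ Set.Ioo 0 M) (hU₀ : IsOpen U₀)
    (hKU : {x : Kerr.region M r₀ | Kerr.rPlus M M ≤ Kerr.radius M (x : E4) ∧ 0 ≤ (x : E4) 0} ⊆ U₀)
    (hΦ : ContDiff ℝ ∞ Φ)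
    (haxi : ∀ (β : ℝ) (z : E4), Φ (E4.axialRotation β z) = Φ z)
    (hsol : ∀ x ∈ U₀, (Kerr.smoothMetric M M r₀).toPseudoRiemannianMetric.dalembertian
      (fun y : Kerr.region M r₀ ↦ Φ y) x = 0)
    {ρ : ℝ} (hloc : ∀ x ∈ U₀, (x : E4) 0 = 0 → ρ < E4.spatialNorm (x : E4) →
      Φ x = 0 ∧ fderiv ℝ Φ x = 0)
    {τ R δ : ℝ} (hτ : 0 ≤ τ) (hδ : 0 < δ) (hR : M + δ ≤ R) :
    shellIntegral (M + δ) R (fun r θ φ ↦ Real.sin θ *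
        (fderiv ℝ Φ (shellPoint M τ r θ φ) (E4.spaceEmbed (sphRadial θ φ))) ^ 2) ≤
      2 / δ ^ 2 * shellIntegral M (max ρ (2 * M) + 2) (fun r θ φ ↦ degTEnergyDensity M Φ 0 r θ φ) := by
  have hΦ1 : ContDiff ℝ 1 Φ := hΦ.of_le (by exact_mod_cast le_top)
  have hMR : M ≤ R := by linarith
  have hsin : Continuous fun q : ℝ × ℝ × ℝ ↦ Real.sin q.2.1 :=
    Real.continuous_sin.comp (continuous_fst.comp continuous_snd)
  have hDc : Continuous fun q : ℝ × ℝ × ℝ ↦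
      fderiv ℝ Φ (shellPoint M τ q.1 q.2.1 q.2.2) (E4.spaceEmbed (sphRadial q.2.1 q.2.2)) :=
    ((hΦ1.continuous_fderiv one_ne_zero).comp (continuous_shellPoint M τ)).clm_apply
      (continuous_spaceEmbed_sphRadial.comp continuous_snd)
  have hD : Continuous fun q : ℝ × ℝ × ℝ ↦ Real.sin q.2.1 *
      (fderiv ℝ Φ (shellPoint M τ q.1 q.2.1 q.2.2) (E4.spaceEmbed (sphRadial q.2.1 q.2.2))) ^ 2 :=
    hsin.mul (hDc.pow 2)
  have hce : Continuous fun q : ℝ × ℝ × ℝ ↦ 2 / δ ^ 2 * degTEnergyDensity M Φ τ q.1 q.2.1 q.2.2 :=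
    continuous_const.mul (continuous_degTEnergyDensity₃ hΦ1 M τ)
  -- (1) pointwise on `[M + δ, R]`: `sin θ (∂_ρΦ)² ≤ (2/δ²) e_T`
  have h1 : shellIntegral (M + δ) R (fun r θ φ ↦ Real.sin θ *
        (fderiv ℝ Φ (shellPoint M τ r θ φ) (E4.spaceEmbed (sphRadial θ φ))) ^ 2) ≤
      shellIntegral (M + δ) R (fun r θ φ ↦ 2 / δ ^ 2 * degTEnergyDensity M Φ τ r θ φ) := by
    refine shellIntegral_mono_on hR hD hce fun r hr θ hθ φ _ ↦ ?_
    have hs : 0 ≤ Real.sin θ := Real.sin_nonneg_of_nonneg_of_le_pi hθ.1 hθ.2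
    have hrM : δ ≤ r - M := by linarith [hr.1]
    have hδr : δ ^ 2 ≤ (r - M) ^ 2 := pow_le_pow_left₀ hδ.le hrM 2
    have hle := sin_mul_degenerate_le_two_mul_degTEnergyDensity hM.le Φ τ
      (show 0 ≤ r by linarith [hr.1]) hθ φ
    have hδ2 : 0 < δ ^ 2 := by positivity
    rw [div_mul_eq_mul_div, le_div_iff₀ hδ2]
    have hX : 0 ≤ Real.sin θ *
        (fderiv ℝ Φ (shellPoint M τ r θ φ) (E4.spaceEmbed (sphRadial θ φ))) ^ 2 :=
      mul_nonneg hs (sq_nonneg _)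
    nlinarith [mul_le_mul_of_nonneg_left hδr hX]
  -- (2) enlarge to `[M, R]` and use the boundedness of the degenerate energy
  have h2 : shellIntegral (M + δ) R (fun r θ φ ↦ degTEnergyDensity M Φ τ r θ φ) ≤
      shellIntegral M R (fun r θ φ ↦ degTEnergyDensity M Φ τ r θ φ) :=
    shellIntegral_mono_interval (by linarith) hR le_rfl (continuous_degTEnergyDensity₃ hΦ1 M τ)
      fun r hr θ hθ φ _ ↦ degTEnergyDensity_nonneg hM.le Φ τ (hM.le.trans hr.1) hθ φ
  have h3 := degTEnergyShell_le_initial hM hr₀ hU₀ hKU hΦ haxi hsol hloc hτ hMR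
  rw [shellIntegral_const_mul] at h1
  have hδ2 : 0 ≤ 2 / δ ^ 2 := by positivity
  exact h1.trans (mul_le_mul_of_nonneg_left (h2.trans h3) hδ2)

end DegenerateEnergy

end Literature.Barriers.FinalStateConjecture.Kerr

namespace Literature.Barriers.FinalStateConjecture

open Literature.Geometry.Lorentzian Kerr

/-- **Reduction of `Aretakis2012_uniformBoundedness` (Thm. 2 with Thm. 4 in shell form, every
radius) to the uniform boundedness of the non-degenerate energy on a collar of the horizon.**
The named fact follows as soon as every globally smooth, everywhere axisymmetric member `Φ` of
Aretakis's class (solving `□_{g_{M,M}}Φ = 0` on an open `U₀ ⊇ {r ≥ M, t* ≥ 0}` of the extremal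
Kerr–Schild chart, data supported in a ball of the initial leaf) admits `δ > 0`, `τ₀`, `C` with
`∫₀^{2π}∫₀^π∫_M^{M+δ} sin θ (∂_ρΦ)²(p(τ, r, θ, φ)) dr dθ dφ ≤ C` for all `τ ≥ τ₀`
(`∂_ρΦ = dΦ(p)(0, n̂)`, `∂_ρ = Y + T`) — in the source the statement of Thm. 2,
`∫_{Σ_τ} J^N_μ[ψ]n^μ ≤ C∫_{Σ₀} J^N_μ[ψ]n^μ` with `J^N_μ n^μ ∼ (Tψ)² + (Yψ)² + |∇̸ψ|²`, restricted
to the collar `{M ≤ r ≤ M + δ}` and to the transversal derivative, whose printed proof is §13.1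
(current `J^{N,δ,−1/2}`, Hardy inequalities, and the integrated decay Prop. 12.5.1 in the
transition region of the cut-off). The rest of the shell bound is supplied by this file: the
`Φ²` term by `Kerr.shellIntegral_sq_le_initialEnergy` (`≤ 8E₀`), the transversal term on
`[M + δ, R₂]` by `Kerr.shellIntegral_rhoDeriv_sq_far_le` (`≤ (2/δ²)E₀`), both for `τ ≥ 0`, with
`E₀` the initial degenerate `T`-energy. No named facts are introduced (D-0026).
[cite: Aretakis2012, §3 Thm. 2, §5.1 Prop. 5.1.2, §4.4 Prop. 4.4.1, §13.1] -/
theorem Aretakis2012_uniformBoundedness_of_nearHorizonBound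
    (Hnear : ∀ [Kerr.Facts] [Kerr.SliceFacts] (M : ℝ), 0 < M → ∀ r₀ ∈ Set.Ioo 0 M,
      ∀ (U₀ : Set (Kerr.region M r₀)) (Φ : E4 → ℝ), IsOpen U₀ →
        {x : Kerr.region M r₀ | Kerr.rPlus M M ≤ Kerr.radius M (x : E4) ∧ 0 ≤ (x : E4) 0} ⊆ U₀ →
        ContDiff ℝ ∞ Φ →
        (∀ x ∈ U₀, (Kerr.smoothMetric M M r₀).toPseudoRiemannianMetric.dalembertian
          (fun y : Kerr.region M r₀ ↦ Φ y) x = 0) →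
        (∃ ρ : ℝ, ∀ x ∈ U₀, (x : E4) 0 = 0 → ρ < E4.spatialNorm (x : E4) →
          Φ x = 0 ∧ fderiv ℝ Φ x = 0) →
        (∀ (β : ℝ) (z : E4), Φ (E4.axialRotation β z) = Φ z) →
        ∃ δ τ₀ C : ℝ, 0 < δ ∧ ∀ τ : ℝ, τ₀ ≤ τ →
          Kerr.shellIntegral M (M + δ) (fun r θ φ ↦ Real.sin θ *
            (fderiv ℝ Φ (Kerr.shellPoint M τ r θ φ) (E4.spaceEmbed (sphRadial θ φ))) ^ 2) ≤ C) :
    Aretakis2012_uniformBoundedness := by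
  intro _ _ M hM r₀ hr₀ U₀ Φ hU₀ hKU hΦ hsol hloc haxi R₂ hR₂
  obtain ⟨δ, τ₀, C, hδ, hC⟩ := Hnear M hM r₀ hr₀ U₀ Φ hU₀ hKU hΦ hsol hloc haxi
  obtain ⟨ρ, hρ⟩ := hloc
  have hΦ1 : ContDiff ℝ 1 Φ := hΦ.of_le (by exact_mod_cast le_top)
  -- the initial degenerate energy
  obtain ⟨E₀, hE₀⟩ : ∃ E₀ : ℝ, E₀ = shellIntegral M (max ρ (2 * M) + 2)
      (fun r θ φ ↦ degTEnergyDensity M Φ 0 r θ φ) := ⟨_, rfl⟩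
  have hE₀0 : 0 ≤ E₀ := hE₀ ▸ initialDegTEnergyShell_nonneg hM hΦ ρ
  refine ⟨max τ₀ 0, 8 * E₀ + (|C| + 2 / δ ^ 2 * E₀), fun τ hτ ↦ ?_⟩
  have hτ₀ : τ₀ ≤ τ := (le_max_left _ _).trans hτ
  have hτ0 : 0 ≤ τ := (le_max_right _ _).trans hτ
  -- continuity of the two integrands
  have hsin : Continuous fun q : ℝ × ℝ × ℝ ↦ Real.sin q.2.1 :=
    Real.continuous_sin.comp (continuous_fst.comp continuous_snd)
  have hsq : Continuous fun q : ℝ × ℝ × ℝ ↦ Real.sin q.2.1 * Φ (shellPoint M τ q.1 q.2.1 q.2.2) ^ 2 :=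
    hsin.mul ((hΦ.continuous.comp (continuous_shellPoint M τ)).pow 2)
  have hDc : Continuous fun q : ℝ × ℝ × ℝ ↦
      fderiv ℝ Φ (shellPoint M τ q.1 q.2.1 q.2.2) (E4.spaceEmbed (sphRadial q.2.1 q.2.2)) :=
    ((hΦ1.continuous_fderiv one_ne_zero).comp (continuous_shellPoint M τ)).clm_apply
      (continuous_spaceEmbed_sphRadial.comp continuous_snd)
  have hD : Continuous fun q : ℝ × ℝ × ℝ ↦ Real.sin q.2.1 *
      (fderiv ℝ Φ (shellPoint M τ q.1 q.2.1 q.2.2) (E4.spaceEmbed (sphRadial q.2.1 q.2.2))) ^ 2 :=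
    hsin.mul (hDc.pow 2)
  -- split the integrand
  have hsplit : shellIntegral M R₂ (fun r θ φ ↦ Real.sin θ *
      (Φ (shellPoint M τ r θ φ) ^ 2 +
        (fderiv ℝ Φ (shellPoint M τ r θ φ) (E4.spaceEmbed (sphRadial θ φ))) ^ 2)) =
      shellIntegral M R₂ (fun r θ φ ↦ Real.sin θ * Φ (shellPoint M τ r θ φ) ^ 2) +
        shellIntegral M R₂ (fun r θ φ ↦ Real.sin θ *
          (fderiv ℝ Φ (shellPoint M τ r θ φ) (E4.spaceEmbed (sphRadial θ φ))) ^ 2) := by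
    rw [← shellIntegral_add hsq hD]
    exact shellIntegral_congr hR₂.le fun r _ θ _ φ _ ↦ mul_add _ _ _
  -- the zeroth-order term
  have hA := shellIntegral_sq_le_initialEnergy hM hr₀ hU₀ hKU hΦ haxi hsol hρ hτ0 hR₂.le
  rw [← hE₀] at hA
  -- the transversal term: collar plus far part
  have hB : shellIntegral M R₂ (fun r θ φ ↦ Real.sin θ *
      (fderiv ℝ Φ (shellPoint M τ r θ φ) (E4.spaceEmbed (sphRadial θ φ))) ^ 2) ≤
      |C| + 2 / δ ^ 2 * E₀ := by
    have hnn : ∀ r ∈ Icc M (max R₂ (M + δ)), ∀ θ ∈ Icc (0 : ℝ) Real.pi,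
        ∀ φ ∈ Icc (0 : ℝ) (2 * Real.pi), 0 ≤ Real.sin θ *
          (fderiv ℝ Φ (shellPoint M τ r θ φ) (E4.spaceEmbed (sphRadial θ φ))) ^ 2 :=
      fun r _ θ hθ φ _ ↦ mul_nonneg (Real.sin_nonneg_of_nonneg_of_le_pi hθ.1 hθ.2) (sq_nonneg _)
    have hfar0 : 0 ≤ 2 / δ ^ 2 * E₀ := by positivity
    rcases le_or_gt R₂ (M + δ) with hle | hlt
    · -- the whole shell lies in the collar
      have h1 : shellIntegral M R₂ (fun r θ φ ↦ Real.sin θ *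
          (fderiv ℝ Φ (shellPoint M τ r θ φ) (E4.spaceEmbed (sphRadial θ φ))) ^ 2) ≤
          shellIntegral M (M + δ) (fun r θ φ ↦ Real.sin θ *
            (fderiv ℝ Φ (shellPoint M τ r θ φ) (E4.spaceEmbed (sphRadial θ φ))) ^ 2) :=
        shellIntegral_mono_interval le_rfl hR₂.le hle hD fun r hr θ hθ φ hφ ↦
          hnn r ⟨hr.1, hr.2.trans (le_max_right _ _)⟩ θ hθ φ hφ
      have h2 := hC τ hτ₀
      linarith [le_abs_self C]
    · -- split at `M + δ`
      rw [shellIntegral_split (b := M + δ) hD]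
      have h2 := hC τ hτ₀
      have h3 := shellIntegral_rhoDeriv_sq_far_le hM hr₀ hU₀ hKU hΦ haxi hsol hρ hτ0 hδ hlt.le
      rw [← hE₀] at h3
      linarith [le_abs_self C]
  rw [hsplit]
  linarith

end Literature.Barriers.FinalStateConjecture

end
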